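import Summits.BirchSwinnertonDyer.BirchSwinnertonDyer.Theorems.SmallImageMuTransferMuTransferX9StepsTwoFourAssembly
import Literature.NumberTheory.EllipticCurves.IwasawaTwistModPkTower
import Literature.NumberTheory.EllipticCurves.IwasawaTwistModPkToOmegaSq
import Summits.BirchSwinnertonDyer.BirchSwinnertonDyer.Theorems.OneSidedTwistSqueezeX9KatoDivisibilityX9StubReciprocityPkX9Pairing
import HarnessLib

set_option autoImplicit false

-- the summit and its single problem are both named `BirchSwinnertonDyer` (registry layout D-0017)
set_option linter.dupNamespace false

/-!
# Crux `KatoDivisibilityX9` (stmt-BirchSwinnertonDyer-20547), line `graded_euler_loss`, stub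
# `stub_reciprocityPkAX9` (hG34ᵍ): prelims of the final assembly of `hKolyRecPk` — the level-`p^{k+1}` pairing
# `e_k : E[p^{k+1}] × E[p^{k+1}] → μ_{p^{k+1}}` in koly's currency (`hsurj`, `ι : μ_{p^{k+1}} ↪ ℤ/p^{k+1}` with
# `ι(e_k(v₀, w₀)) = 1`), and `T^ε` on `H¹` as `twistModPkShiftEmbed ∘ twistModPkTruncate`

Seat `bsd-line-k6-p4` (prover-bsd-line-k6-p4-g5-0, wave-2 stub worker B).  THEOREMS ONLY (no definition, no named
fact, no `sorry`); `--supports stmt-BirchSwinnertonDyer-20547 --as helper`.  Level-`p^{k+1}` twins of lur-b's §1 of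
`…X9StepsTwoFourAssembly` (`weilPairingHom_right_surjective`, `exists_iota_weilPairingHom_eq_one`, there over the
FIELD `ℤ/p`): over `ℤ/p^{k+1}` the unit `ι(e(v₀,w₀))` needs a value of exact order `p^{k+1}`, which exists because
`E[p^{k+1}] ⊄ E[p^k]` (`#E[n] = n²`) and the pairing is non-degenerate on both sides (alternating + right
non-degenerate).

* `exists_pow_smul_ne_zero` (`∃ a ∈ E[p^{k+1}], p^k a ≠ 0`);
* `left_nondegenerate_of_alternating`, `right_surjective_of_nondegenerate` (`#Hom(E[p^{k+1}], μ) ≤ #E[p^{k+1}]`),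
  **`exists_iota_apply_eq_one`**;
* `pow_smul_eq_zero_of_not_isUnit` (`x ∈ ℤ/p^{k+1}` non-unit ⟹ `p^k x = 0`);
* **`shiftH1Pk_iterate_eq_map_shiftEmbed_truncate`** — `(T·)^[a] = H¹(twistModPkShiftEmbed ∘ twistModPkTruncate)`
  at level `J − a` (the two spellings of the test class's local condition: v3/v4 `hKolyRecPk` vs koly's `hΨS`).

References: J. H. Silverman, *AEC* III §8 (Weil pairing), Cor. III.6.4 [SilvermanAEC2009]; J. S. Milne, *Arithmetic
Duality Theorems* I §0 [MilneADT2006]; L. Washington, GTM 83, §13.1–13.2 [Washington1997].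
-/

noncomputable section

open scoped NumberField ContRepresentation
open Function Field
open Literature.NumberTheory.GaloisRepresentations
open Literature.NumberTheory.EllipticCurves
open Literature.NumberTheory.EllipticCurves.ZpExtension
open WeierstrassCurve (geomPoints geomTorsion galoisRepTorsion)
open Summit.BirchSwinnertonDyer.BirchSwinnertonDyer.Rank1Residual
open Summit.BirchSwinnertonDyer.BirchSwinnertonDyer.Theorems.OneSidedTwistSqueezeX9KatoDivisibilityX9StubReciprocityPkX9Pairing

universe u

namespace Summit.BirchSwinnertonDyer.BirchSwinnertonDyer.Theorems.OneSidedTwistSqueezeX9KatoDivisibilityX9KolyvaginReciprocityPkAssemblyPrelims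

/-! ## §1 The level-`p^{k+1}` pairing in koly's currency -/

section Pairing

variable (W : WeierstrassCurve ℚ) [W.IsElliptic] (p : ℕ) [Fact p.Prime] (k : ℕ)

/-- **`E[p^{k+1}] ⊄ E[p^k]`**: some `a ∈ E[p^{k+1}]` has `p^k·a ≠ 0` (cardinalities `p^{2(k+1)} > p^{2k}`).
[cite: SilvermanAEC2009, Cor. III.6.4(b)] -/
theorem exists_pow_smul_ne_zero : ∃ a : geomTorsion W ((p : ℤ) ^ (k + 1)), p ^ k • a ≠ 0 := by
  have hp : p.Prime := Fact.out
  by_contra h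
  push Not at h
  -- then `E[p^{k+1}] ↪ E[p^k]`
  have hmem : ∀ a : geomTorsion W ((p : ℤ) ^ (k + 1)), (a : geomPoints W) ∈ geomTorsion W ((p : ℤ) ^ k) := by
    intro a
    rw [WeierstrassCurve.mem_geomTorsion_iff, ← Nat.cast_pow, natCast_zsmul]
    have := congrArg (fun P : geomTorsion W ((p : ℤ) ^ (k + 1)) => (P : geomPoints W)) (h a)
    simpa only [AddSubmonoidClass.coe_nsmul, ZeroMemClass.coe_zero] using this
  haveI := finite_geomTorsion_pow W p k
  have hle : Nat.card (geomTorsion W ((p : ℤ) ^ (k + 1))) ≤ Nat.card (geomTorsion W ((p : ℤ) ^ k)) :=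
    Nat.card_le_card_of_injective (fun a => (⟨(a : geomPoints W), hmem a⟩ : geomTorsion W ((p : ℤ) ^ k)))
      fun a b hab => Subtype.ext (Subtype.mk.inj hab)
  rw [natCard_geomTorsion_pow W p, natCard_geomTorsion_pow W p] at hle
  have hlt : p ^ (2 * k) < p ^ (2 * (k + 1)) := Nat.pow_lt_pow_right hp.one_lt (by omega)
  omega

variable (ek : geomTorsion W ((p : ℤ) ^ (k + 1)) →+ geomTorsion W ((p : ℤ) ^ (k + 1)) →+
  DiscreteGaloisModule.MuCarrier ℚ (p ^ (k + 1)))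

omit [W.IsElliptic] [Fact p.Prime] in
/-- **Left non-degeneracy from alternating + right non-degeneracy** (`e(S,T) = −e(T,S)` by polarisation).
[cite: SilvermanAEC2009, Prop. III.8.1] -/
theorem left_nondegenerate_of_alternating (halt : ∀ T, ek T T = 0) (hnd : ∀ T, (∀ S, ek S T = 0) → T = 0)
    (S : geomTorsion W ((p : ℤ) ^ (k + 1))) (hS : ∀ T, ek S T = 0) : S = 0 := by
  refine hnd S fun T => ?_
  have h := halt (S + T)
  simp only [map_add, AddMonoidHom.add_apply, halt, hS, zero_add, add_zero] at h
  exact h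

/-- **Perfectness on the right**: every additive character `χ : E[p^{k+1}] → μ_{p^{k+1}}` is `e(·, b)` for some `b`
(non-degeneracy + counting: `#Hom(E[p^{k+1}], μ) ≤ #E[p^{k+1}]`). [cite: SilvermanAEC2009, Prop. III.8.1] -/
theorem right_surjective_of_nondegenerate (hnd : ∀ T, (∀ S, ek S T = 0) → T = 0)
    (χ : geomTorsion W ((p : ℤ) ^ (k + 1)) →+ DiscreteGaloisModule.MuCarrier ℚ (p ^ (k + 1))) :
    ∃ b, ∀ a, ek a b = χ a := by
  haveI : NeZero (p ^ (k + 1)) := ⟨pow_ne_zero _ (Fact.out : p.Prime).ne_zero⟩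
  haveI := finite_geomTorsion_pow W p (k + 1)
  -- the injective map `b ↦ e(·, b)`
  let F : geomTorsion W ((p : ℤ) ^ (k + 1)) →
      (geomTorsion W ((p : ℤ) ^ (k + 1)) →+ DiscreteGaloisModule.MuCarrier ℚ (p ^ (k + 1))) :=
    fun b => ek.flip b
  have hF : Function.Injective F := fun b b' hbb' => by
    rw [← sub_eq_zero]
    refine hnd _ fun a => ?_
    have h := DFunLike.congr_fun hbb' a
    simp only [F, AddMonoidHom.flip_apply] at h
    rw [map_sub, h, sub_self]
  -- counting
  let ι : DiscreteGaloisModule.MuCarrier ℚ (p ^ (k + 1)) →+ ZMod (p ^ (k + 1)) :=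
    (muEquivZMod ℚ (p ^ (k + 1))).toAddMonoidHom
  have hι : Function.Injective ι := (muEquivZMod ℚ (p ^ (k + 1))).injective
  haveI : Finite (geomTorsion W ((p : ℤ) ^ (k + 1)) →+ ZMod (p ^ (k + 1))) :=
    Finite.of_injective (fun f : geomTorsion W ((p : ℤ) ^ (k + 1)) →+ ZMod (p ^ (k + 1)) =>
      (f : geomTorsion W ((p : ℤ) ^ (k + 1)) → ZMod (p ^ (k + 1)))) DFunLike.coe_injective
  have hcomp : Function.Injective
      (fun f : geomTorsion W ((p : ℤ) ^ (k + 1)) →+ DiscreteGaloisModule.MuCarrier ℚ (p ^ (k + 1)) =>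
        ι.comp f) :=
    fun f g hfg => AddMonoidHom.ext fun a => hι (DFunLike.congr_fun hfg a)
  haveI : Finite (geomTorsion W ((p : ℤ) ^ (k + 1)) →+ DiscreteGaloisModule.MuCarrier ℚ (p ^ (k + 1))) :=
    Finite.of_injective _ hcomp
  have hcard : Nat.card (geomTorsion W ((p : ℤ) ^ (k + 1)) →+ DiscreteGaloisModule.MuCarrier ℚ (p ^ (k + 1))) ≤
      Nat.card (geomTorsion W ((p : ℤ) ^ (k + 1))) :=
    (Nat.card_le_card_of_injective _ hcomp).trans
      (LocalSplitPrime.natCard_addMonoidHom_zmod_le (geomTorsion W ((p : ℤ) ^ (k + 1))) (p ^ (k + 1)))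
  obtain ⟨b, hb⟩ := (hF.bijective_of_nat_card_le hcard).2 χ
  exact ⟨b, fun a => by rw [← hb]; rfl⟩

omit [W.IsElliptic] in
/-- In `ℤ/p^{k+1}`, a non-unit is killed by `p^k` (`x = p·y`). [folklore] -/
theorem pow_smul_eq_zero_of_not_isUnit {x : ZMod (p ^ (k + 1))} (hx : ¬ IsUnit x) : p ^ k • x = 0 := by
  have hp : p.Prime := Fact.out
  haveI : NeZero (p ^ (k + 1)) := ⟨pow_ne_zero _ hp.ne_zero⟩
  have hdvd : p ∣ x.val := by
    by_contra hnd
    apply hx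
    rw [← ZMod.natCast_zmod_val x, ZMod.isUnit_iff_coprime]
    exact (Nat.coprime_pow_right_iff (Nat.succ_pos k) _ _).mpr ((Nat.coprime_comm).mp (hp.coprime_iff_not_dvd.mpr hnd))
  obtain ⟨c, hc⟩ := hdvd
  rw [← ZMod.natCast_zmod_val x, hc, nsmul_eq_mul, ← Nat.cast_mul, ← mul_assoc, ← pow_succ, Nat.cast_mul,
    ZMod.natCast_self, zero_mul]

/-- **An injective trivialisation `ι : μ_{p^{k+1}} ↪ ℤ/p^{k+1}` with `ι(e(v₀, w₀)) = 1`** for some torsion points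
`v₀, w₀`: some value of the pairing has exact order `p^{k+1}` (else every value is killed by `p^k`, so `p^k·E[p^{k+1}]`
pairs trivially with everything and vanishes by left non-degeneracy — contradicting `E[p^{k+1}] ⊄ E[p^k]`).
[cite: SilvermanAEC2009, Prop. III.8.1 and Cor. III.6.4(b)] -/
theorem exists_iota_apply_eq_one (halt : ∀ T, ek T T = 0) (hnd : ∀ T, (∀ S, ek S T = 0) → T = 0) :
    ∃ (ι : DiscreteGaloisModule.MuCarrier ℚ (p ^ (k + 1)) →+ ZMod (p ^ (k + 1)))
      (v₀ w₀ : geomTorsion W ((p : ℤ) ^ (k + 1))), Function.Injective ι ∧ ι (ek v₀ w₀) = 1 := by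
  have hp : p.Prime := Fact.out
  haveI : NeZero (p ^ (k + 1)) := ⟨pow_ne_zero _ hp.ne_zero⟩
  -- some value is a unit under `μ ≃ ℤ/p^{k+1}`
  have hex : ∃ v₀ w₀, IsUnit (muEquivZMod ℚ (p ^ (k + 1)) (ek v₀ w₀)) := by
    by_contra h
    push Not at h
    obtain ⟨a, ha⟩ := exists_pow_smul_ne_zero W p k
    refine ha (left_nondegenerate_of_alternating W p k ek halt hnd _ fun T => ?_)
    rw [map_nsmul, AddMonoidHom.nsmul_apply]
    apply (muEquivZMod ℚ (p ^ (k + 1))).injective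
    rw [map_nsmul, map_zero]
    exact pow_smul_eq_zero_of_not_isUnit p k (h a T)
  obtain ⟨v₀, w₀, hu⟩ := hex
  obtain ⟨c, hc⟩ := hu
  refine ⟨(AddMonoidHom.mulLeft ((c⁻¹ : (ZMod (p ^ (k + 1)))ˣ) : ZMod (p ^ (k + 1)))).comp
    (muEquivZMod ℚ (p ^ (k + 1))).toAddMonoidHom, v₀, w₀, fun x y hxy => ?_, ?_⟩
  · have h := congrArg (fun z => (c : ZMod (p ^ (k + 1))) * z) hxy
    simp only [AddMonoidHom.coe_comp, Function.comp_apply, AddMonoidHom.coe_mulLeft, ← mul_assoc,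
      Units.mul_inv, one_mul] at h
    exact (muEquivZMod ℚ (p ^ (k + 1))).injective h
  · change ((c⁻¹ : (ZMod (p ^ (k + 1)))ˣ) : ZMod (p ^ (k + 1))) * muEquivZMod ℚ (p ^ (k + 1)) (ek v₀ w₀) = 1
    rw [← hc, Units.inv_mul]

end Pairing

/-! ## §2 `T^ε` on `H¹(K, 𝒯_J^{(k)})` as `twistModPkShiftEmbed ∘ twistModPkTruncate` -/

section Shift

variable {K : Type u} [Field K] {p : ℕ} [Fact p.Prime] (κ : ZpExtension K p)
variable {M : Type u} [AddCommGroup M] [TopologicalSpace M] [DiscreteTopology M] {k : ℕ}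
variable (ρ : DiscreteGaloisModule K M) (hM : ∀ x : M, p ^ k • x = 0) (J : ℕ)

/-- **`(T·)_*^{[a]} = H¹((T^{J−(J−a)}·) ∘ (· mod T^{J−a}))` on `H¹(K, 𝒯_J^{(k)})`**: the iterate of `shiftH1Pk` is the
map induced by `twistModPkShiftEmbed ∘ twistModPkTruncate` at level `J − a` (both are `H¹` of `S^a`,
`twistModPkShiftEmbed_twistModPkTruncate_apply`). [cite: SerreGaloisCohomology1997, I §2.2] [cite: Washington1997, §13.1–§13.2] -/
theorem shiftH1Pk_iterate_eq_map_shiftEmbed_truncate (a : ℕ) (c : galoisCohomology (κ.twistModPk ρ hM J) 1) :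
    (κ.shiftH1Pk ρ hM J)^[a] c =
      galoisCohomology.map (κ.twistModPkShiftEmbed ρ hM J (Nat.sub_le J a)) 1
        (galoisCohomology.map (κ.twistModPkTruncate ρ hM J (Nat.sub_le J a)) 1 c) := by
  have key : ∀ b : ℕ, (κ.shiftH1Pk ρ hM J)^[b] c =
      galoisCohomology.map ((κ.twistModPkShiftEmbed ρ hM J (Nat.sub_le J b)).comp
        (κ.twistModPkTruncate ρ hM J (Nat.sub_le J b))) 1 c := by
    intro b
    induction b with
    | zero =>
      rw [Function.iterate_zero_apply]
      have h1 : galoisCohomology.map (ContIntertwiningMap.id :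
          (κ.twistModPk ρ hM J).toContRepresentation →ⁱL (κ.twistModPk ρ hM J).toContRepresentation) 1 c = c := by
        obtain ⟨φ, rfl⟩ := oneCocycleClass_surjective _ c
        rw [galoisCohomology.map_oneCocycleClass_ofHom]
        exact congrArg _ (Subtype.ext (ContinuousMap.ext fun _ => rfl))
      refine h1.symm.trans (galoisCohomology.map_congr_apply _ _ (fun x => ?_) c)
      change x = κ.twistModPkShiftEmbed ρ hM J (Nat.sub_le J 0) (κ.twistModPkTruncate ρ hM J (Nat.sub_le J 0) x)
      rw [twistModPkShiftEmbed_twistModPkTruncate_apply, pow_zero, Module.End.one_apply]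
    | succ b ih =>
      rw [Function.iterate_succ_apply', ih, shiftH1Pk]
      refine galoisCohomology.map_map_of_comp_apply _ _ _ (fun x => ?_) c
      change κ.twistModPkShiftEmbed ρ hM J (Nat.sub_le J (b + 1))
          (κ.twistModPkTruncate ρ hM J (Nat.sub_le J (b + 1)) x) =
        shiftEnd M J (κ.twistModPkShiftEmbed ρ hM J (Nat.sub_le J b) (κ.twistModPkTruncate ρ hM J (Nat.sub_le J b) x))
      rw [twistModPkShiftEmbed_twistModPkTruncate_apply, twistModPkShiftEmbed_twistModPkTruncate_apply,
        ← Module.End.mul_apply, ← pow_succ']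
  rw [key a]
  exact (galoisCohomology.map_map_of_comp_apply _ _ _ (fun _ => rfl) c).symm

end Shift

end Summit.BirchSwinnertonDyer.BirchSwinnertonDyer.Theorems.OneSidedTwistSqueezeX9KatoDivisibilityX9KolyvaginReciprocityPkAssemblyPrelims

end
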